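import Literature.AnabelianGeometry.EtaleTheta.Discharge.Sec3Thm37ModelType
import Literature.AnabelianGeometry.EtaleTheta.Discharge.Sec3Thm37UnitProfinite
import Literature.AnabelianGeometry.EtaleTheta.Discharge.Sec3Thm37RatStdOfLine
import Literature.AnabelianGeometry.EtaleTheta.Discharge.Sec3Prop34CnstOfRlfQ
import Literature.AnabelianGeometry.EtaleTheta.Discharge.Sec3Prop34CnstOfRlfRFinite
import Literature.AnabelianGeometry.EtaleTheta.Discharge.Sec3RatFnMonoidOn
import HarnessLib

/-!
# [EtTh] Theorem 3.7 (i)–(iv) — END KNIT: one closing theorem per constructed Def. 3.6 (i) datum,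
# every proved sub-DAG row plugged BY NAME, residual binders literal (proof-only)

S. Mochizuki, *The étale theta function and its Frobenioid-theoretic manifestations*, Publ. RIMS **45**
(2009) [EtTh], Thm. 3.7 (i)–(iv), PDF pp. 79–80 (printed pp. 305–306), proof p. 306 ll. 1–17
[cite: MochizukiEtTh2009, Thm 3.7 p.79]; [FrdI] Thm. 5.2 (ii)/(iii), Def. 4.5 [MochizukiFrdI2008].

abc-iut cell, layer L2, node **EtTh:Thm3.7** — «END KNIT» (abc-iut-L2-lead gen 3, RULINGS #13 (R129); seat
abc-iut-w5-d164 gen 3, writer of `plan/L2/SUBDAG-EtTh-Thm37.md`).  The sub-DAG rows (§A L01–L07, §B L08–L11,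
§C L12–L14/L00, (ii) standard/ratStd, §F v3.2–v3.4) are all PROVED in the tree modulo named interface
hypotheses; THIS FILE (no definitions, no `Prop` facts) composes them, clause by clause, in the tree's REAL
[FrdI] vocabulary (the [FrdI]-type fields of abc-iut-L2-t3's `FrobenioidFacade` are free predicates, so (i)/(ii)
are stated with L1's genuine predicates exactly as the row closers prove them; (iii) uses the real
`AutActionFactorsThrough` / `AutActionFaithful` over the constant-field functor `(D → D₀) ⋙ cnst`; (iv) is the
facade-free named `Prop` `Thm37_iv`):

* `thm37_of_inputs` — for ANY tempered Frobenioid over the canonical category vocabulary `treeCatVocab`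
  (any monoid type `Λ`): (i) ∧ (ii) ∧ (iii) ∧ (iv) from the LITERAL residual binder list
  { `hBmon` ([FrdI] Thm. 5.2 preamble "`𝔹` a monoid on `D`", sub-DAG R4 — structurally = `hBinj` + `hFSM` by
    abc-iut-L1-t1's `isMonoidOn_ratFnFunctor`, cf. `thm37_of_structural_inputs`),
    `hP34` (R1: Prop. 3.4 (ii) iso 1 `Ker(B₀^Λ(Y)ˣ → (Φ₀^ℝ)^gp(Y)) ≅ O_L^×` in tree currency — only if `Λ = ℤ`),
    `hinj` (R2: `B₀^ℝ → (Φ₀^ℝ)^gp` injective — only if `Λ = ℝ`; a THEOREM at `ofRlfR`),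
    `hD`, `hnd` (print's hypotheses of (ii): `D` of FSMFF-type, `Φ` non-dilating), `hrat` (print's "if, moreover,
    `Φ` is rational"), `hKfix` ("`Π^tp_X` acts trivially on `K^×/O_K^×`", p. 306 — DERIVED at `ℤ`-monoprime
    `Φ^{bs-fld}` from the constant-line data `hLine`/`hInt` by abc-iut-w5-d250, `Sec3Thm37RatStdOfLine`, G-w5d250-1),
    `P : Prop34Cnst T cnst` (R3′: the Prop. 3.4 (ii) clauses relative to `D₀ → D^cnst`) };
* `thm37_ofRlfZ_of_inputs` (`Λ = ℤ`, `T := ofRlfZ dm hpf`): `P` ⟸ `dm.Prop34` + `dm.Prop34Cnst₀ cnst`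
  (abc-iut-L6-t12, p418261), `hinj` vacuous;
* `thm37_ofRlfQ_of_inputs` (`Λ = ℚ`, `T := ofRlfQ dm hpf`): `P` ⟸ `dm.Prop34` + `Prop34Cnst₀` + **`hQ`** (G-w4d084-2,
  abc-iut-w4-d084 p427133); both unit conjuncts of (i) and (iv) vacuous (`Λ ∉ {ℤ, ℝ}`);
* `thm37_ofRlfR_of_inputs` (`Λ = ℝ`, `T := ofRlfR dm hpf`): `P` ⟸ `Prop34Cnst₀` + **`hE`** (G-w5d130-1, abc-iut-w5-d130
  p424819 — clause 1 NOT derivable over abstract data, countermodel p424811), `hinj` a theorem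
  (`ofRlfR_divΛ_injective`), `hP34` vacuous, (iii) second clause vacuous; and
  `thm37_ofRlfR_fin_of_inputs`: `hE` ⟸ `dm.Prop34` in print's setting "finitely many primes of each `Φ₀(Y)`,
  each `Φ₀(Y)_𝔭 ≅ ℤ_{≥0}` or `ℚ_{≥0}`" (abc-iut-w5-d130, `Sec3Prop34CnstOfRlfRFinite`).

HONEST FRAMING: bookkeeping over PROVED rows; refereed pre-IUT material; no statement of [EtTh]/[FrdI] is
strengthened; every residual is a property of the Def. 3.3 (iii)/3.6 (i) data dischargeable only by the
geometric instantiation of those data (campaign-L side).  Nothing here bears on [IUTchIII] Cor. 3.12.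
Typed ≠ proved — here PROVED modulo the literal binders.
-/

namespace Literature.AnabelianGeometry.EtaleTheta

open CategoryTheory Opposite Literature.AlgebraicGeometry.Frobenioids

namespace TemperedFrobenioid

universe u₀ v₀ u₁ v₁ u v w uK

/-! ### §1 Any monoid type: Theorem 3.7 (i)–(iv) at the canonical vocabulary from the literal residual binders -/

section AnyType

variable {D₀ : Type u₀} [Category.{v₀} D₀] {V : FrdIMonoidStub.{w}}
  {T : RealifiedDivisorMonoids (D₀ := D₀) V} {D : Type u} [Category.{v} D]
  {IsRational IsStrictlyRational : (Dᵒᵖ ⥤ CommMonCat.{w}) → Prop}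
  (C₀ : TemperedFrobenioid T D (treeCatVocab D IsRational IsStrictlyRational))
  {Dcnst : Type u₁} [Category.{v₁} Dcnst] {cnst : D₀ ⥤ Dcnst} (p : ℕ) [Fact p.Prime]

/-- **[EtTh] Theorem 3.7 (i)–(iv) — END KNIT at the canonical vocabulary, any monoid type.**  For a tempered
Frobenioid `C` (Def. 3.6 (ii)) over `treeCatVocab`, from the literal residual binders
{`hBmon`, `hP34` (`Λ = ℤ` only), `hinj` (`Λ = ℝ` only), `hD`, `hnd`, `hrat`, `hKfix`, `P : Prop34Cnst T cnst`}:
(i) "if `Λ = ℤ` (resp. `Λ = ℝ`) then `C` is of unit-profinite (resp. unit-trivial) type; of isotropic, model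
[hence birationally Frobenius-normalized], sub-quasi-Frobenius-trivial type, not of group-like type" (rows L01–L07:
`thm37_i_treeClauses5_treeCatVocab`, `isOfUnitProfiniteType_of_kerIsoPadicUnits`,
`thm37_i_unitTrivial_of_divΛ_injective`); (ii) "`C` is of standard type; if `Φ` is rational, of rationally standard
type" (`isOfStandardType_treeCatVocab`, `thm37_ii_ratStd_treeCatVocab'`); (iii) "the action of `Aut_C(A)` on
`O^▷(A)`, `O^×(A)` factors through `Aut_{D^cnst}(A^cnst)`; faithful if `Λ ∈ {ℤ, ℚ}`" (rows L08–L11: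
`autActionFactorsThrough_of_prop34Cnst`, `autActionFaithful_of_prop34Cnst`); (iv) "`D` slim, `Λ ∈ {ℤ, ℝ}` ⇒ `C`
slim" (rows L12–L14: `thm37_iv_of_kerIsoPadicUnits` / `thm37_iv_of_divΛ_injective`).  `hF` ([FrdI] Thm. 5.2 (ii))
is L1's theorem `isFrobenioid_treeCatVocab_of_isMonoidOn hBmon` throughout. [cite: MochizukiEtTh2009, Thm 3.7 p.79] -/
theorem thm37_of_inputs (hBmon : IsMonoidOn C₀.ratFnFunctor)
    (hP34 : C₀.monoidType = MonoidType.Z → ∀ A : Dᵒᵖ, ∃ L : PadicFrd.PadicFld.{uK} p, L.IsPadicLocal ∧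
      Nonempty (((T.divΛ (C₀.baseOp A)).comp (Units.coeHom (T.BΛ.obj (C₀.baseOp A)))).ker ≃*
        PadicFrd.unitSubgroup L.K))
    (hinj : C₀.monoidType = MonoidType.R → ∀ A : Dᵒᵖ, Function.Injective (T.divΛ (C₀.baseOp A)))
    (hD : IsOfFSMFFType D) (hnd : IsNonDilatingOn C₀.divisorMonoid)
    (hrat : ∀ X : C₀.category,
      PreFrobenioidData.IsRational
        (PreFrobenioid.biratData (C₀.isFrobenioid_treeCatVocab_of_isMonoidOn hBmon)
          (PreFrobenioid.hasBiratSquares_of_isFrobenioid (C₀.isFrobenioid_treeCatVocab_of_isMonoidOn hBmon)))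
        (S := PreFrobenioidData.ofFunctor C₀.divisorMonoid C₀.toElem) (fun a 𝔭 => PrimarySupp a 𝔭) X)
    (hKfix : ∀ (A : D) (f : A ≅ A) (b : T.BΛ.obj (C₀.baseOp (op A)))
      (ξ : Algebra.GrothendieckGroup (C₀.Φ.carrier (op A))),
      b ∈ T.FΛ (C₀.baseOp (op A)) → (b, ξ) ∈ C₀.ratFn (op A) → pullGp C₀.divisorMonoid f.hom ξ = ξ)
    (P : T.Prop34Cnst cnst) :
    -- (i)
    ((C₀.monoidType = MonoidType.Z → PreFrobenioid.IsOfUnitProfiniteType C₀.toElem) ∧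
      (C₀.monoidType = MonoidType.R → PreFrobenioid.IsOfType (PreFrobenioid.IsUnitTrivial C₀.toElem)) ∧
      PreFrobenioid.IsOfIsotropicType C₀.toElem ∧
      PreFrobenioid.IsOfModelType C₀.toElem (C₀.isFrobenioid_treeCatVocab_of_isMonoidOn hBmon)
        (PreFrobenioid.hasBiratSquares_of_isFrobenioid (C₀.isFrobenioid_treeCatVocab_of_isMonoidOn hBmon)) ∧
      PreFrobenioidData.IsOfBiratFrobeniusNormalizedType
        (PreFrobenioid.biratData (C₀.isFrobenioid_treeCatVocab_of_isMonoidOn hBmon)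
          (PreFrobenioid.hasBiratSquares_of_isFrobenioid (C₀.isFrobenioid_treeCatVocab_of_isMonoidOn hBmon))) ∧
      PreFrobenioid.IsOfType (PreFrobenioid.IsSubQuasiFrobeniusTrivial C₀.toElem) ∧
      ¬ PreFrobenioid.IsOfType (PreFrobenioid.IsGroupLikeObj C₀.toElem)) ∧
    -- (ii)
    ((ModelFrobenioid.data C₀.divisorMonoid C₀.ratFnFunctor C₀.divBNatTrans).IsOfStandardType ∧
      (PreFrobenioidData.ofFunctor C₀.divisorMonoid C₀.toElem).IsOfRationallyStandardType
        (PreFrobenioid.rsParams (C₀.isFrobenioid_treeCatVocab_of_isMonoidOn hBmon) fun a 𝔭 => PrimarySupp a 𝔭)) ∧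
    -- (iii)
    ((∀ A : C₀.category, FrobenioidFacade.AutActionFactorsThrough (C₀.base ⋙ cnst) C₀.toElem A) ∧
      (C₀.monoidType = MonoidType.Z ∨ C₀.monoidType = MonoidType.Q →
        ∀ A : C₀.category, FrobenioidFacade.AutActionFaithful (C₀.base ⋙ cnst) C₀.toElem A)) ∧
    -- (iv)
    C₀.Thm37_iv := by
  have hF := C₀.isFrobenioid_treeCatVocab_of_isMonoidOn hBmon
  obtain ⟨h1, h2, h3, h4, h5⟩ := C₀.thm37_i_treeClauses5_treeCatVocab hBmon
  refine ⟨⟨fun hZ => C₀.isOfUnitProfiniteType_of_kerIsoPadicUnits hF (hP34 hZ),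
      fun hR => C₀.thm37_i_unitTrivial_of_divΛ_injective hF (hinj hR), h1, h2, h3, h4, h5⟩,
    ⟨C₀.isOfStandardType_treeCatVocab hBmon hD hnd, C₀.thm37_ii_ratStd_treeCatVocab' hBmon hD hnd hrat hKfix⟩,
    ⟨fun A => C₀.autActionFactorsThrough_of_prop34Cnst P A, fun hΛ A => C₀.autActionFaithful_of_prop34Cnst P hΛ A⟩,
    fun hslim hΛ => ?_⟩
  rcases hΛ with hZ | hR
  · exact C₀.thm37_iv_of_kerIsoPadicUnits hF (hP34 hZ) hslim (Or.inl hZ)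
  · exact C₀.thm37_iv_of_divΛ_injective hF (hinj hR) hslim (Or.inr hR)

/-- **The structural form of `hBmon`** ([FrdI] Thm. 5.2 preamble): pull-backs of `B₀^Λ` injective and
FSM-morphisms of `D` invertible (abc-iut-L1-t1, `Sec3RatFnMonoidOn`) — so every `hBmon` above may be read as
{`hBinj`, `hFSM`}. [cite: MochizukiEtTh2009, Def 3.6 p.77] -/
theorem hBmon_of_structural
    (hBinj : ∀ {Y Y' : D₀ᵒᵖ} (g : Y ⟶ Y'), Function.Injective (T.BΛ.map g).hom)
    (hFSM : ∀ {A B : D} (α : B ⟶ A), IsFSM α → IsIso α) : IsMonoidOn C₀.ratFnFunctor :=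
  C₀.isMonoidOn_ratFnFunctor hBinj hFSM

end AnyType

/-! ### §2 `Λ = ℤ`: the constructed data `ofRlfZ dm hpf` -/

section OfRlfZ

variable {D₀ : Type u₀} [Category.{v₀} D₀] {dm : DivisorMonoids.{u₀, v₀, w} D₀}
  {hpf : ∀ Y : D₀ᵒᵖ, IsPerfFactorial (dm.Φ₀.obj Y)} {V : FrdIMonoidStub.{w}} {V₀ : FrdICatStub.{u₀, v₀, w} D₀}
  {D : Type u} [Category.{v} D] {IsRational IsStrictlyRational : (Dᵒᵖ ⥤ CommMonCat.{w}) → Prop}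
  (C₀ : TemperedFrobenioid (RealifiedDivisorMonoids.ofRlfZ dm hpf) D (treeCatVocab D IsRational IsStrictlyRational))
  {Dcnst : Type u₁} [Category.{v₁} Dcnst] {cnst : D₀ ⥤ Dcnst} (p : ℕ) [Fact p.Prime]

/-- **[EtTh] Theorem 3.7 (i)–(iv) for a tempered Frobenioid of monoid type `ℤ` over the CONSTRUCTED Def. 3.6 (i)
data `ofRlfZ dm hpf`** (abc-iut-L6-t12; `Φ₀^ℝ = Φ₀^rlf`, `B₀^ℤ = B₀`, `F₀^ℤ = F₀`), residual binders literal: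
{`hBmon` (R4), `hP34` (R1, Prop. 3.4 (ii) iso 1), `hD`, `hnd`, `hrat`, `hKfix` (G-w5d250-1; derived at `ℤ`-monoprime
`Φ^{bs-fld}` by `Sec3Thm37RatStdOfLine`), `h34 : dm.Prop34`, `h₀ : dm.Prop34Cnst₀ cnst` (R3′ at the `B₀`-level,
p418261)}.  Unit-profinite type from `hP34`; the `Λ = ℝ` conjunct is vacuous; (iii) both clauses (`Λ = ℤ`).
[cite: MochizukiEtTh2009, Thm 3.7 p.79] -/
theorem thm37_ofRlfZ_of_inputs (hBmon : IsMonoidOn C₀.ratFnFunctor)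
    (hP34 : ∀ A : Dᵒᵖ, ∃ L : PadicFrd.PadicFld.{uK} p, L.IsPadicLocal ∧
      Nonempty ((((RealifiedDivisorMonoids.ofRlfZ dm hpf).divΛ (C₀.baseOp A)).comp
        (Units.coeHom ((RealifiedDivisorMonoids.ofRlfZ dm hpf).BΛ.obj (C₀.baseOp A)))).ker ≃*
        PadicFrd.unitSubgroup L.K))
    (hD : IsOfFSMFFType D) (hnd : IsNonDilatingOn C₀.divisorMonoid)
    (hrat : ∀ X : C₀.category,
      PreFrobenioidData.IsRational
        (PreFrobenioid.biratData (C₀.isFrobenioid_treeCatVocab_of_isMonoidOn hBmon)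
          (PreFrobenioid.hasBiratSquares_of_isFrobenioid (C₀.isFrobenioid_treeCatVocab_of_isMonoidOn hBmon)))
        (S := PreFrobenioidData.ofFunctor C₀.divisorMonoid C₀.toElem) (fun a 𝔭 => PrimarySupp a 𝔭) X)
    (hKfix : ∀ (A : D) (f : A ≅ A) (b : (RealifiedDivisorMonoids.ofRlfZ dm hpf).BΛ.obj (C₀.baseOp (op A)))
      (ξ : Algebra.GrothendieckGroup (C₀.Φ.carrier (op A))),
      b ∈ (RealifiedDivisorMonoids.ofRlfZ dm hpf).FΛ (C₀.baseOp (op A)) → (b, ξ) ∈ C₀.ratFn (op A) →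
        pullGp C₀.divisorMonoid f.hom ξ = ξ)
    (h34 : dm.Prop34 V V₀) (h₀ : dm.Prop34Cnst₀ cnst) :
    (PreFrobenioid.IsOfUnitProfiniteType C₀.toElem ∧
      PreFrobenioid.IsOfIsotropicType C₀.toElem ∧
      PreFrobenioid.IsOfModelType C₀.toElem (C₀.isFrobenioid_treeCatVocab_of_isMonoidOn hBmon)
        (PreFrobenioid.hasBiratSquares_of_isFrobenioid (C₀.isFrobenioid_treeCatVocab_of_isMonoidOn hBmon)) ∧
      PreFrobenioidData.IsOfBiratFrobeniusNormalizedType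
        (PreFrobenioid.biratData (C₀.isFrobenioid_treeCatVocab_of_isMonoidOn hBmon)
          (PreFrobenioid.hasBiratSquares_of_isFrobenioid (C₀.isFrobenioid_treeCatVocab_of_isMonoidOn hBmon))) ∧
      PreFrobenioid.IsOfType (PreFrobenioid.IsSubQuasiFrobeniusTrivial C₀.toElem) ∧
      ¬ PreFrobenioid.IsOfType (PreFrobenioid.IsGroupLikeObj C₀.toElem)) ∧
    ((ModelFrobenioid.data C₀.divisorMonoid C₀.ratFnFunctor C₀.divBNatTrans).IsOfStandardType ∧
      (PreFrobenioidData.ofFunctor C₀.divisorMonoid C₀.toElem).IsOfRationallyStandardType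
        (PreFrobenioid.rsParams (C₀.isFrobenioid_treeCatVocab_of_isMonoidOn hBmon) fun a 𝔭 => PrimarySupp a 𝔭)) ∧
    ((∀ A : C₀.category,
        FrobenioidFacade.AutActionFactorsThrough (C₀.base ⋙ cnst) C₀.toElem A) ∧
      (∀ A : C₀.category, FrobenioidFacade.AutActionFaithful (C₀.base ⋙ cnst) C₀.toElem A)) ∧
    C₀.Thm37_iv := by
  have hZ : C₀.monoidType = MonoidType.Z := rfl
  obtain ⟨⟨hi1, -, hi3, hi4, hi5, hi6, hi7⟩, hii, ⟨hiii1, hiii2⟩, hiv⟩ :=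
    C₀.thm37_of_inputs p hBmon (fun _ => hP34) (fun hR => absurd (hZ.symm.trans hR) (by decide)) hD hnd hrat hKfix
      (RealifiedDivisorMonoids.Prop34Cnst.ofRlfZ h34 h₀)
  exact ⟨⟨hi1 hZ, hi3, hi4, hi5, hi6, hi7⟩, hii, ⟨hiii1, hiii2 (Or.inl hZ)⟩, hiv⟩

end OfRlfZ

/-! ### §3 `Λ = ℚ`: the constructed data `ofRlfQ dm hpf` -/

section OfRlfQ

variable {D₀ : Type u₀} [Category.{v₀} D₀] {dm : DivisorMonoids.{u₀, v₀, w} D₀}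
  {hpf : ∀ Y : D₀ᵒᵖ, IsPerfFactorial (dm.Φ₀.obj Y)} {V : FrdIMonoidStub.{w}} {V₀ : FrdICatStub.{u₀, v₀, w} D₀}
  {D : Type u} [Category.{v} D] {IsRational IsStrictlyRational : (Dᵒᵖ ⥤ CommMonCat.{w}) → Prop}
  (C₀ : TemperedFrobenioid (RealifiedDivisorMonoids.ofRlfQ dm hpf) D (treeCatVocab D IsRational IsStrictlyRational))
  {Dcnst : Type u₁} [Category.{v₁} Dcnst] {cnst : D₀ ⥤ Dcnst}

/-- **[EtTh] Theorem 3.7 (i)–(iii) for a tempered Frobenioid of monoid type `ℚ` over the CONSTRUCTED data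
`ofRlfQ dm hpf`** (abc-iut-L1-d2 / abc-iut-w4-d084; `B₀^ℚ = B₀^pf`, `F₀^ℚ = F₀^pf`), residual binders literal:
{`hBmon`, `hD`, `hnd`, `hrat`, `hKfix`, `h34 : dm.Prop34`, `h₀ : dm.Prop34Cnst₀ cnst`, **`hQ`** (automorphisms agreeing
on `Ker(div₀)` up to torsion have the same image under `cnst` — the kernel-exact residual of clause 4, G-w4d084-2,
p427133)}.  Both unit conjuncts of (i) and clause (iv) are VACUOUS at `Λ = ℚ` (print restricts them to `ℤ`/`ℝ`);
(iii) second clause applies (`Λ ∈ {ℤ, ℚ}`). [cite: MochizukiEtTh2009, Thm 3.7 p.79] -/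
theorem thm37_ofRlfQ_of_inputs (hBmon : IsMonoidOn C₀.ratFnFunctor)
    (hD : IsOfFSMFFType D) (hnd : IsNonDilatingOn C₀.divisorMonoid)
    (hrat : ∀ X : C₀.category,
      PreFrobenioidData.IsRational
        (PreFrobenioid.biratData (C₀.isFrobenioid_treeCatVocab_of_isMonoidOn hBmon)
          (PreFrobenioid.hasBiratSquares_of_isFrobenioid (C₀.isFrobenioid_treeCatVocab_of_isMonoidOn hBmon)))
        (S := PreFrobenioidData.ofFunctor C₀.divisorMonoid C₀.toElem) (fun a 𝔭 => PrimarySupp a 𝔭) X)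
    (hKfix : ∀ (A : D) (f : A ≅ A) (b : (RealifiedDivisorMonoids.ofRlfQ dm hpf).BΛ.obj (C₀.baseOp (op A)))
      (ξ : Algebra.GrothendieckGroup (C₀.Φ.carrier (op A))),
      b ∈ (RealifiedDivisorMonoids.ofRlfQ dm hpf).FΛ (C₀.baseOp (op A)) → (b, ξ) ∈ C₀.ratFn (op A) →
        pullGp C₀.divisorMonoid f.hom ξ = ξ)
    (h34 : dm.Prop34 V V₀) (h₀ : dm.Prop34Cnst₀ cnst)
    (hQ : ∀ {Y : D₀} (g g' : Y ≅ Y),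
      (∀ b : dm.B₀.obj (op Y), dm.div₀ (op Y) b = 1 →
        ∃ N : ℕ+, ((dm.B₀.map g.hom.op).hom b) ^ (N : ℕ) = ((dm.B₀.map g'.hom.op).hom b) ^ (N : ℕ)) →
      cnst.map g.hom = cnst.map g'.hom) :
    (PreFrobenioid.IsOfIsotropicType C₀.toElem ∧
      PreFrobenioid.IsOfModelType C₀.toElem (C₀.isFrobenioid_treeCatVocab_of_isMonoidOn hBmon)
        (PreFrobenioid.hasBiratSquares_of_isFrobenioid (C₀.isFrobenioid_treeCatVocab_of_isMonoidOn hBmon)) ∧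
      PreFrobenioidData.IsOfBiratFrobeniusNormalizedType
        (PreFrobenioid.biratData (C₀.isFrobenioid_treeCatVocab_of_isMonoidOn hBmon)
          (PreFrobenioid.hasBiratSquares_of_isFrobenioid (C₀.isFrobenioid_treeCatVocab_of_isMonoidOn hBmon))) ∧
      PreFrobenioid.IsOfType (PreFrobenioid.IsSubQuasiFrobeniusTrivial C₀.toElem) ∧
      ¬ PreFrobenioid.IsOfType (PreFrobenioid.IsGroupLikeObj C₀.toElem)) ∧
    ((ModelFrobenioid.data C₀.divisorMonoid C₀.ratFnFunctor C₀.divBNatTrans).IsOfStandardType ∧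
      (PreFrobenioidData.ofFunctor C₀.divisorMonoid C₀.toElem).IsOfRationallyStandardType
        (PreFrobenioid.rsParams (C₀.isFrobenioid_treeCatVocab_of_isMonoidOn hBmon) fun a 𝔭 => PrimarySupp a 𝔭)) ∧
    ((∀ A : C₀.category,
        FrobenioidFacade.AutActionFactorsThrough (C₀.base ⋙ cnst) C₀.toElem A) ∧
      (∀ A : C₀.category, FrobenioidFacade.AutActionFaithful (C₀.base ⋙ cnst) C₀.toElem A)) := by
  have hQΛ : C₀.monoidType = MonoidType.Q := rfl
  obtain ⟨⟨-, -, hi3, hi4, hi5, hi6, hi7⟩, hii, ⟨hiii1, hiii2⟩, -⟩ :=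
    thm37_of_inputs.{u₀, v₀, u₁, v₁, u, v, w, 0} C₀ 2 hBmon (fun hZ => absurd (hQΛ.symm.trans hZ) (by decide))
      (fun hR => absurd (hQΛ.symm.trans hR) (by decide)) hD hnd hrat hKfix
      (RealifiedDivisorMonoids.Prop34Cnst.ofRlfQ h34 h₀ hQ)
  exact ⟨⟨hi3, hi4, hi5, hi6, hi7⟩, hii, ⟨hiii1, hiii2 (Or.inr hQΛ)⟩⟩

/-- At `Λ = ℚ` the typed clause (iv) holds VACUOUSLY (its hypothesis `Λ ∈ {ℤ, ℝ}` fails), for the record.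
[cite: MochizukiEtTh2009, Thm 3.7 p.80] -/
theorem thm37_iv_ofRlfQ_vacuous : C₀.Thm37_iv := by
  have hQΛ : C₀.monoidType = MonoidType.Q := rfl
  intro _ hΛ
  rcases hΛ with h | h
  · exact absurd (hQΛ.symm.trans h) (by decide)
  · exact absurd (hQΛ.symm.trans h) (by decide)

end OfRlfQ

/-! ### §4 `Λ = ℝ`: the constructed data `ofRlfR dm hpf` -/

section OfRlfR

variable {D₀ : Type u₀} [Category.{v₀} D₀] {dm : DivisorMonoids.{u₀, v₀, w} D₀}
  {hpf : ∀ Y : D₀ᵒᵖ, IsPerfFactorial (dm.Φ₀.obj Y)} {V : FrdIMonoidStub.{w}} {V₀ : FrdICatStub.{u₀, v₀, w} D₀}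
  {D : Type u} [Category.{v} D] {IsRational IsStrictlyRational : (Dᵒᵖ ⥤ CommMonCat.{w}) → Prop}
  (C₀ : TemperedFrobenioid (RealifiedDivisorMonoids.ofRlfR dm hpf) D (treeCatVocab D IsRational IsStrictlyRational))
  {Dcnst : Type u₁} [Category.{v₁} Dcnst] {cnst : D₀ ⥤ Dcnst}

/-- **[EtTh] Theorem 3.7 (i)–(iv) for a tempered Frobenioid of monoid type `ℝ` over the CONSTRUCTED data
`ofRlfR dm hpf`** (abc-iut-L6-t12; `B₀^ℝ = ℝ·Φ₀^birat`, `F₀^ℝ = ℝ·Φ₀^cnst`), residual binders literal: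
{`hBmon`, `hD`, `hnd`, `hrat`, `hKfix`, `h₀ : dm.Prop34Cnst₀ cnst`, **`hE`** (clause 1 of Prop. 3.4 (ii) at `Λ = ℝ`:
"effective elements of `ℝ·Φ₀^birat` are constant" — G-w5d130-1, NOT derivable over abstract data, p424811)}.
Unit-TRIVIAL type outright (`ofRlfR_divΛ_injective`, w5-d164 p414061); unit-profinite conjunct and (iii) second
clause vacuous (`Λ = ℝ`); (iv) outright modulo `hBmon`. [cite: MochizukiEtTh2009, Thm 3.7 p.79] -/
theorem thm37_ofRlfR_of_inputs (hBmon : IsMonoidOn C₀.ratFnFunctor)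
    (hD : IsOfFSMFFType D) (hnd : IsNonDilatingOn C₀.divisorMonoid)
    (hrat : ∀ X : C₀.category,
      PreFrobenioidData.IsRational
        (PreFrobenioid.biratData (C₀.isFrobenioid_treeCatVocab_of_isMonoidOn hBmon)
          (PreFrobenioid.hasBiratSquares_of_isFrobenioid (C₀.isFrobenioid_treeCatVocab_of_isMonoidOn hBmon)))
        (S := PreFrobenioidData.ofFunctor C₀.divisorMonoid C₀.toElem) (fun a 𝔭 => PrimarySupp a 𝔭) X)
    (hKfix : ∀ (A : D) (f : A ≅ A) (b : (RealifiedDivisorMonoids.ofRlfR dm hpf).BΛ.obj (C₀.baseOp (op A)))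
      (ξ : Algebra.GrothendieckGroup (C₀.Φ.carrier (op A))),
      b ∈ (RealifiedDivisorMonoids.ofRlfR dm hpf).FΛ (C₀.baseOp (op A)) → (b, ξ) ∈ C₀.ratFn (op A) →
        pullGp C₀.divisorMonoid f.hom ξ = ξ)
    (h₀ : dm.Prop34Cnst₀ cnst)
    (hE : ∀ (Y : D₀) (b : Algebra.GrothendieckGroup ((RealifiedDivisorMonoids.realData dm hpf).rlf.obj (op Y)))
      (x : (hpf (op Y)).Rlf),
      b ∈ ((RealifiedDivisorMonoids.realData dm hpf).realSpan dm.biratGp).carrier Y →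
        b = Algebra.GrothendieckGroup.of x →
        b ∈ ((RealifiedDivisorMonoids.realData dm hpf).realSpan dm.cnstGp).carrier Y) :
    (PreFrobenioid.IsOfType (PreFrobenioid.IsUnitTrivial C₀.toElem) ∧
      PreFrobenioid.IsOfIsotropicType C₀.toElem ∧
      PreFrobenioid.IsOfModelType C₀.toElem (C₀.isFrobenioid_treeCatVocab_of_isMonoidOn hBmon)
        (PreFrobenioid.hasBiratSquares_of_isFrobenioid (C₀.isFrobenioid_treeCatVocab_of_isMonoidOn hBmon)) ∧
      PreFrobenioidData.IsOfBiratFrobeniusNormalizedType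
        (PreFrobenioid.biratData (C₀.isFrobenioid_treeCatVocab_of_isMonoidOn hBmon)
          (PreFrobenioid.hasBiratSquares_of_isFrobenioid (C₀.isFrobenioid_treeCatVocab_of_isMonoidOn hBmon))) ∧
      PreFrobenioid.IsOfType (PreFrobenioid.IsSubQuasiFrobeniusTrivial C₀.toElem) ∧
      ¬ PreFrobenioid.IsOfType (PreFrobenioid.IsGroupLikeObj C₀.toElem)) ∧
    ((ModelFrobenioid.data C₀.divisorMonoid C₀.ratFnFunctor C₀.divBNatTrans).IsOfStandardType ∧
      (PreFrobenioidData.ofFunctor C₀.divisorMonoid C₀.toElem).IsOfRationallyStandardType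
        (PreFrobenioid.rsParams (C₀.isFrobenioid_treeCatVocab_of_isMonoidOn hBmon) fun a 𝔭 => PrimarySupp a 𝔭)) ∧
    (∀ A : C₀.category, FrobenioidFacade.AutActionFactorsThrough (C₀.base ⋙ cnst) C₀.toElem A) ∧
    C₀.Thm37_iv := by
  have hR : C₀.monoidType = MonoidType.R := rfl
  obtain ⟨⟨-, hi2, hi3, hi4, hi5, hi6, hi7⟩, hii, ⟨hiii1, -⟩, hiv⟩ :=
    thm37_of_inputs.{u₀, v₀, u₁, v₁, u, v, w, 0} C₀ 2 hBmon (fun hZ => absurd (hR.symm.trans hZ) (by decide))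
      (fun _ A => RealifiedDivisorMonoids.ofRlfR_divΛ_injective dm hpf (C₀.baseOp A)) hD hnd hrat hKfix
      (RealifiedDivisorMonoids.Prop34Cnst.ofRlfR_of_eff h₀ hE)
  exact ⟨⟨hi2 hR, hi3, hi4, hi5, hi6, hi7⟩, hii, hiii1, hiv⟩

/-- **The same in PRINT's setting for the `Λ = ℝ` clause 1** — "finitely many primes of each `Φ₀(Y)`, each
`Φ₀(Y)_𝔭 ≅ ℤ_{≥0}` or `ℚ_{≥0}`" (genuine divisor monoids of tempered coverings): `hE` is then a THEOREM of
`dm.Prop34` (abc-iut-w5-d130, `Prop34Cnst.ofRlfR_of_finite_intPrimes`, via the rational-cone lemma of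
abc-iut-w5-d098), so the residual list is {`hBmon`, `hD`, `hnd`, `hrat`, `hKfix`, `h34`, `h₀`, `hfin`, `hZQ`}.
[cite: MochizukiEtTh2009, Thm 3.7 p.79] -/
theorem thm37_ofRlfR_fin_of_inputs (hBmon : IsMonoidOn C₀.ratFnFunctor)
    (hD : IsOfFSMFFType D) (hnd : IsNonDilatingOn C₀.divisorMonoid)
    (hrat : ∀ X : C₀.category,
      PreFrobenioidData.IsRational
        (PreFrobenioid.biratData (C₀.isFrobenioid_treeCatVocab_of_isMonoidOn hBmon)
          (PreFrobenioid.hasBiratSquares_of_isFrobenioid (C₀.isFrobenioid_treeCatVocab_of_isMonoidOn hBmon)))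
        (S := PreFrobenioidData.ofFunctor C₀.divisorMonoid C₀.toElem) (fun a 𝔭 => PrimarySupp a 𝔭) X)
    (hKfix : ∀ (A : D) (f : A ≅ A) (b : (RealifiedDivisorMonoids.ofRlfR dm hpf).BΛ.obj (C₀.baseOp (op A)))
      (ξ : Algebra.GrothendieckGroup (C₀.Φ.carrier (op A))),
      b ∈ (RealifiedDivisorMonoids.ofRlfR dm hpf).FΛ (C₀.baseOp (op A)) → (b, ξ) ∈ C₀.ratFn (op A) →
        pullGp C₀.divisorMonoid f.hom ξ = ξ)
    (h34 : dm.Prop34 V V₀) (h₀ : dm.Prop34Cnst₀ cnst)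
    (hfin : ∀ Y : D₀, Finite (Primes (dm.Φ₀.obj (op Y))))
    (hZQ : ∀ (Y : D₀) (𝔭 : Primes (dm.Φ₀.obj (op Y))), IsZMonoprime ↥𝔭.submonoid ∨ IsQMonoprime ↥𝔭.submonoid) :
    (PreFrobenioid.IsOfType (PreFrobenioid.IsUnitTrivial C₀.toElem) ∧
      PreFrobenioid.IsOfIsotropicType C₀.toElem ∧
      PreFrobenioid.IsOfModelType C₀.toElem (C₀.isFrobenioid_treeCatVocab_of_isMonoidOn hBmon)
        (PreFrobenioid.hasBiratSquares_of_isFrobenioid (C₀.isFrobenioid_treeCatVocab_of_isMonoidOn hBmon)) ∧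
      PreFrobenioidData.IsOfBiratFrobeniusNormalizedType
        (PreFrobenioid.biratData (C₀.isFrobenioid_treeCatVocab_of_isMonoidOn hBmon)
          (PreFrobenioid.hasBiratSquares_of_isFrobenioid (C₀.isFrobenioid_treeCatVocab_of_isMonoidOn hBmon))) ∧
      PreFrobenioid.IsOfType (PreFrobenioid.IsSubQuasiFrobeniusTrivial C₀.toElem) ∧
      ¬ PreFrobenioid.IsOfType (PreFrobenioid.IsGroupLikeObj C₀.toElem)) ∧
    ((ModelFrobenioid.data C₀.divisorMonoid C₀.ratFnFunctor C₀.divBNatTrans).IsOfStandardType ∧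
      (PreFrobenioidData.ofFunctor C₀.divisorMonoid C₀.toElem).IsOfRationallyStandardType
        (PreFrobenioid.rsParams (C₀.isFrobenioid_treeCatVocab_of_isMonoidOn hBmon) fun a 𝔭 => PrimarySupp a 𝔭)) ∧
    (∀ A : C₀.category, FrobenioidFacade.AutActionFactorsThrough (C₀.base ⋙ cnst) C₀.toElem A) ∧
    C₀.Thm37_iv := by
  have hR : C₀.monoidType = MonoidType.R := rfl
  obtain ⟨⟨-, hi2, hi3, hi4, hi5, hi6, hi7⟩, hii, ⟨hiii1, -⟩, hiv⟩ :=
    thm37_of_inputs.{u₀, v₀, u₁, v₁, u, v, w, 0} C₀ 2 hBmon (fun hZ => absurd (hR.symm.trans hZ) (by decide))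
      (fun _ A => RealifiedDivisorMonoids.ofRlfR_divΛ_injective dm hpf (C₀.baseOp A)) hD hnd hrat hKfix
      (RealifiedDivisorMonoids.Prop34Cnst.ofRlfR_of_finite_intPrimes h34 h₀ hfin hZQ)
  exact ⟨⟨hi2 hR, hi3, hi4, hi5, hi6, hi7⟩, hii, hiii1, hiv⟩

end OfRlfR

end TemperedFrobenioid

end Literature.AnabelianGeometry.EtaleTheta
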